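import Literature.NumberTheory.Transcendental.BallRivoalSeries
import Literature.NumberTheory.Transcendental.PeriodsWave0
import HarnessLib

/-!
# Ball–Rivoal series, III: the linear forms in odd zeta values (Rivoal's Lemme 1 and Lemme 5)

Topic `Literature/NumberTheory/Transcendental`. Continuation of `BallRivoalSeries.lean`, toward
the discharge of **periods.S19** (`Literature.NumberTheory.Transcendental.ball_rivoal`). With the
partial fraction coefficients `c_{o,p}` of Rivoal's `R_n` (`BallRivoal.exists_pf_R`; `c_{o,p}` is
Rivoal's `c_{o+1,p,n}`) we prove:

* uniqueness of partial fraction data (`pf_unique`), hence from the reflection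
  `R_n(-t-n-2) = (-1)^{a(n+1)} R_n(t)` (`R_reflect`) the symmetry
  `c_{o,n-p} = (-1)^{o+1+a(n+1)} c_{o,p}` (`pf_R_symm`; [Rivoal2000, proof of Lemme 1]:
  "`c_{i,n-j,n} = (-1)^{a-i}(-1)^{an} c_{i,j,n}`"), so that for `n` even and `a` odd the
  coefficients of the even zeta values vanish (`sum_c_eq_zero_of_odd`);
* `R_n(k) ≥ 0`, `R_n(k) ≤ C/(k+1)²` on `ℕ` (`R_natCast_nonneg`, `R_natCast_le`) and
  `∑_p c_{0,p} = 0` (`sum_c_zero_eq_zero`: the order at infinity of `R_n` is `≥ 2`);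
* **Lemme 1** (`hasSum_R`): `S_n(1) = ∑_{k ≥ 0} R_n(k) = P_0 + ∑_{2 ≤ i ≤ a} P_i ζ(i)` with
  `P_i = ∑_p c_{i-1,p}`, `P_0 = -∑_{i ≤ a} ∑_p c_{i-1,p} H_p^{(i)}`, `H_p^{(i)} = ∑_{m ≤ p} m^{-i}`
  (`harm`), and `ζ(i) = zetaValue i` of `PeriodsWave0.lean`;
* **Lemme 5** (`isInt_dpow_mul_sum_c`, `isInt_dpow_mul_P0`): `d^a P_i ∈ ℤ`, `d^a P_0 ∈ ℤ` for
  any common multiple `d` of `1, …, n` (in the application `d = d_n = lcm(1, …, n)`).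

Everything is PROVED; no named facts.

## References

* [Rivoal2000] T. Rivoal, C. R. Acad. Sci. Paris Sér. I 331 (2000) 267–270, arXiv:math/0008051,
  §2, Lemme 1 (with its proof) and Lemme 5.
-/

noncomputable section

open Finset Filter Topology Polynomial

namespace Literature.NumberTheory.Transcendental

namespace BallRivoal

/-! ### Linearity of `pfEval` -/

/-- `pfEval` of a difference of data. [folklore] -/
theorem pfEval_sub' (n K : ℕ) (c₁ c₂ : ℕ → ℕ → ℚ) (t : ℚ) :
    pfEval n K (fun o p => c₁ o p - c₂ o p) t = pfEval n K c₁ t - pfEval n K c₂ t := by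
  unfold pfEval
  rw [← sum_sub_distrib]
  refine sum_congr rfl fun p _ => ?_
  rw [← sum_sub_distrib]
  exact sum_congr rfl fun o _ => by ring

/-- `pfEval` of scaled data. [folklore] -/
theorem pfEval_const_mul (n K : ℕ) (s : ℚ) (c : ℕ → ℕ → ℚ) (t : ℚ) :
    pfEval n K (fun o p => s * c o p) t = s * pfEval n K c t := by
  unfold pfEval
  rw [mul_sum]
  refine sum_congr rfl fun p _ => ?_
  rw [mul_sum]
  exact sum_congr rfl fun o _ => by ring

/-! ### Uniqueness of partial fraction data -/

/-- If the data `c` (orders `< K+1`) evaluate to `0` at all large natural `t`, the top-order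
coefficients vanish: clear denominators to get a polynomial with infinitely many roots and
evaluate it at the pole `-p₀-1`. [folklore] -/
theorem pf_top_eq_zero (n K : ℕ) (c : ℕ → ℕ → ℚ) (T : ℕ)
    (h : ∀ t : ℕ, T ≤ t → pfEval n (K + 1) c t = 0) (p₀ : ℕ) (hp₀ : p₀ ≤ n) : c K p₀ = 0 := by
  classical
  set Q : ℚ[X] := ∑ p ∈ range (n + 1), ∑ o ∈ range (K + 1),
      C (c o p) * ((X + C (p : ℚ) + 1) ^ (K - o) *
        ∏ q ∈ (range (n + 1)).erase p, (X + C (q : ℚ) + 1) ^ (K + 1)) with hQ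
  have hQeval : ∀ t : ℚ, Q.eval t = ∑ p ∈ range (n + 1), ∑ o ∈ range (K + 1),
      c o p * ((t + p + 1) ^ (K - o) * ∏ q ∈ (range (n + 1)).erase p, (t + q + 1) ^ (K + 1)) := by
    intro t
    simp only [hQ, eval_finsetSum, eval_mul, eval_C, eval_pow, eval_add, eval_X, eval_one,
      eval_prod]
  -- `Q` vanishes at the large naturals
  have hzero : ∀ t : ℕ, T ≤ t → Q.eval (t : ℚ) = 0 := by
    intro t ht
    have hpos : ∀ m : ℕ, (t : ℚ) + m + 1 ≠ 0 := fun m => by positivity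
    have e : Q.eval (t : ℚ) =
        pfEval n (K + 1) c t * ∏ q ∈ range (n + 1), ((t : ℚ) + q + 1) ^ (K + 1) := by
      rw [hQeval, pfEval, sum_mul]
      refine sum_congr rfl fun p hp => ?_
      rw [sum_mul]
      refine sum_congr rfl fun o ho => ?_
      have ho' : o ≤ K := Nat.lt_succ_iff.1 (mem_range.1 ho)
      rw [← mul_prod_erase _ _ hp]
      have hsplit : ((t : ℚ) + p + 1) ^ (K + 1) = ((t : ℚ) + p + 1) ^ (o + 1) * ((t : ℚ) + p + 1) ^ (K - o) := by
        rw [← pow_add]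
        congr 1
        omega
      rw [hsplit]
      have := hpos p
      field_simp
    rw [e, h t ht, zero_mul]
  have hQ0 : Q = 0 := by
    apply Polynomial.eq_zero_of_infinite_isRoot
    apply Set.infinite_of_not_bddAbove
    rintro ⟨B, hB⟩
    set t : ℕ := max T (⌈B⌉₊ + 1) with ht
    have hroot : (t : ℚ) ∈ {x | Q.IsRoot x} := by
      simp only [Set.mem_setOf_eq, IsRoot.def]
      exact hzero t (le_max_left _ _)
    have h1 : (t : ℚ) ≤ B := hB hroot
    have h2 : B < t := by
      have : (⌈B⌉₊ : ℚ) + 1 ≤ t := by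
        rw [ht]
        exact_mod_cast le_max_right T (⌈B⌉₊ + 1)
      linarith [Nat.le_ceil B]
    linarith
  -- evaluate at the pole `-p₀-1`
  have hev : Q.eval (-(p₀ : ℚ) - 1) =
      c K p₀ * ∏ q ∈ (range (n + 1)).erase p₀, (-(p₀ : ℚ) - 1 + q + 1) ^ (K + 1) := by
    rw [hQeval, sum_eq_single p₀, sum_eq_single K]
    · have : (-(p₀ : ℚ) - 1 + p₀ + 1) ^ (K - K) = 1 := by simp
      rw [this, one_mul]
    · intro o ho hne
      have ho' : o < K := lt_of_le_of_ne (Nat.lt_succ_iff.1 (mem_range.1 ho)) hne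
      have : (-(p₀ : ℚ) - 1 + p₀ + 1) ^ (K - o) = 0 := by
        rw [show (-(p₀ : ℚ) - 1 + p₀ + 1) = 0 by ring, zero_pow (by omega)]
      rw [this, zero_mul, mul_zero]
    · intro hK
      exact absurd (mem_range.2 (Nat.lt_succ_self K)) hK
    · intro p hp hne
      refine sum_eq_zero fun o _ => ?_
      have hmem : p₀ ∈ (range (n + 1)).erase p :=
        mem_erase.2 ⟨hne.symm, mem_range.2 (Nat.lt_succ_of_le hp₀)⟩
      rw [prod_eq_zero hmem (by rw [show (-(p₀ : ℚ) - 1 + p₀ + 1) = 0 by ring, zero_pow (by omega)]),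
        mul_zero, mul_zero]
    · intro hp
      exact absurd (mem_range.2 (Nat.lt_succ_of_le hp₀)) hp
  have hprod : ∏ q ∈ (range (n + 1)).erase p₀, (-(p₀ : ℚ) - 1 + q + 1) ^ (K + 1) ≠ 0 := by
    refine prod_ne_zero_iff.2 fun q hq => pow_ne_zero _ ?_
    have hne : q ≠ p₀ := (mem_erase.1 hq).1
    intro h0
    apply hne
    exact_mod_cast (by linarith : (q : ℚ) = p₀)
  have h0 : Q.eval (-(p₀ : ℚ) - 1) = 0 := by rw [hQ0, eval_zero]
  rw [hev] at h0
  exact (mul_eq_zero.1 h0).resolve_right hprod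

/-- **Uniqueness of partial fraction data**: data evaluating to `0` at all large naturals vanish
on their support. [folklore] -/
theorem pf_unique (n : ℕ) : ∀ (K : ℕ) (c : ℕ → ℕ → ℚ) (T : ℕ),
    (∀ t : ℕ, T ≤ t → pfEval n K c t = 0) → ∀ o p, o < K → p ≤ n → c o p = 0 := by
  intro K
  induction K with
  | zero => intro c T _ o p ho _; exact absurd ho (Nat.not_lt_zero o)
  | succ K ih =>
    intro c T h o p ho hp
    have htop : ∀ p', p' ≤ n → c K p' = 0 := pf_top_eq_zero n K c T h
    rcases Nat.lt_succ_iff_lt_or_eq.1 ho with ho' | rfl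
    · refine ih c T (fun t ht => ?_) o p ho' hp
      have := h t ht
      unfold pfEval at this ⊢
      rw [← this]
      refine sum_congr rfl fun p' hp' => ?_
      rw [sum_range_succ, htop p' (Nat.lt_succ_iff.1 (mem_range.1 hp')), zero_div, add_zero]
    · exact htop p hp

/-! ### The reflection `t ↦ -t-n-2` -/

/-- `(-t-k+1)_k = (-1)^k (t)_k`. [folklore] -/
theorem poch_reflect (t : ℚ) (k : ℕ) : poch (-t - k + 1) k = (-1) ^ k * poch t k := by
  rw [poch, poch, ← prod_range_reflect,
    show ((-1 : ℚ)) ^ k = ∏ _s ∈ range k, (-1 : ℚ) by rw [prod_const, card_range],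
    ← prod_mul_distrib]
  refine prod_congr rfl fun s hs => ?_
  have hs' : s < k := mem_range.1 hs
  rw [Nat.cast_sub (by omega : s ≤ k - 1), Nat.cast_sub (by omega : 1 ≤ k)]
  push_cast
  ring

/-- **Reflection symmetry of `R_n`** ("well-poised"): `R_n(-t-n-2) = (-1)^{a(n+1)} R_n(t)`
(the identity `(α)_l = (-1)^l(-α-l+1)_l` applied to the three Pochhammer symbols; this is
`Φ_{n,n-j}(n-x) = (-1)^{na}Φ_{n,j}(x)` of [Rivoal2000, proof of Lemme 1]).
[cite: Rivoal2000, §2 proof of Lemme 1] -/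
theorem R_reflect (a r n : ℕ) (t : ℚ) :
    R a r n (-t - n - 2) = (-1) ^ (a * (n + 1)) * R a r n t := by
  have e1 : poch (-t - n - 2 - r * n + 1) (r * n) = (-1) ^ (r * n) * poch (t + n + 2) (r * n) := by
    rw [← poch_reflect (t + n + 2) (r * n)]
    congr 1
    push_cast
    ring
  have e2 : poch (-t - n - 2 + n + 2) (r * n) = (-1) ^ (r * n) * poch (t - r * n + 1) (r * n) := by
    rw [← poch_reflect (t - r * n + 1) (r * n)]
    congr 1
    push_cast
    ring
  have e3 : poch (-t - n - 2 + 1) (n + 1) = (-1) ^ (n + 1) * poch (t + 1) (n + 1) := by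
    rw [← poch_reflect (t + 1) (n + 1)]
    congr 1
    push_cast
    ring
  rw [R, R, e1, e2, e3, mul_pow, ← pow_mul]
  have hsq : ((-1 : ℚ) ^ (r * n)) * ((-1 : ℚ) ^ (r * n)) = 1 := by
    rw [← pow_add, ← two_mul, pow_mul]
    norm_num
  have hN : (n.factorial : ℚ) ^ (a - 2 * r) * ((-1) ^ (r * n) * poch (t + n + 2) (r * n)) *
      ((-1) ^ (r * n) * poch (t - r * n + 1) (r * n)) =
      (n.factorial : ℚ) ^ (a - 2 * r) * poch (t - r * n + 1) (r * n) * poch (t + n + 2) (r * n) := by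
    calc (n.factorial : ℚ) ^ (a - 2 * r) * ((-1) ^ (r * n) * poch (t + n + 2) (r * n)) *
          ((-1) ^ (r * n) * poch (t - r * n + 1) (r * n))
        = (n.factorial : ℚ) ^ (a - 2 * r) * poch (t - r * n + 1) (r * n) *
            poch (t + n + 2) (r * n) * (((-1 : ℚ) ^ (r * n)) * ((-1 : ℚ) ^ (r * n))) := by ring
      _ = _ := by rw [hsq, mul_one]
  rw [hN]
  have hinv : ((-1 : ℚ) ^ ((n + 1) * a))⁻¹ = (-1) ^ (a * (n + 1)) := by
    rw [← inv_pow, inv_neg_one, mul_comm]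
  rw [mul_comm ((-1 : ℚ) ^ ((n + 1) * a)) _, ← div_div, div_eq_mul_inv _ ((-1 : ℚ) ^ ((n + 1) * a)),
    hinv]
  ring

/-- Reflected data evaluate to the evaluation at the reflected point:
`∑ (-1)^{o+1} c_{o,n-p}/(t+p+1)^{o+1} = ∑ c_{o,p}/((-t-n-2)+p+1)^{o+1}`. [folklore] -/
theorem pfEval_reflect (n K : ℕ) (c : ℕ → ℕ → ℚ) (t : ℚ) :
    pfEval n K (fun o p => (-1) ^ (o + 1) * c o (n - p)) t = pfEval n K c (-t - n - 2) := by
  unfold pfEval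
  conv_rhs => rw [← sum_range_reflect]
  refine sum_congr rfl fun p hp => sum_congr rfl fun o _ => ?_
  have hp' : p ≤ n := Nat.lt_succ_iff.1 (mem_range.1 hp)
  have e1 : n + 1 - 1 - p = n - p := by omega
  have e2 : (-t - n - 2 + ((n - p : ℕ) : ℚ) + 1) = (-1) * (t + p + 1) := by
    rw [Nat.cast_sub hp']
    ring
  rw [e1, e2, mul_pow]
  have hinv : ((-1 : ℚ) ^ (o + 1))⁻¹ = (-1) ^ (o + 1) := by rw [← inv_pow, inv_neg_one]
  rw [div_mul_eq_div_div, div_eq_mul_inv _ ((-1 : ℚ) ^ (o + 1)), hinv]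
  ring

/-- **Symmetry of the partial fraction coefficients of `R_n`** ([Rivoal2000, proof of Lemme 1]:
`c_{i,n-j,n} = (-1)^{a-i}(-1)^{an} c_{i,j,n}`; here `i = o + 1` and the sign is written
`(-1)^{o+1}(-1)^{a(n+1)}`). [cite: Rivoal2000, §2 proof of Lemme 1] -/
theorem pf_R_symm (a r n : ℕ) (c : ℕ → ℕ → ℚ)
    (hc : ∀ t : ℚ, (∀ m, m ≤ n → t + m + 1 ≠ 0) → pfEval n a c t = R a r n t)
    (o p : ℕ) (ho : o < a) (hp : p ≤ n) :
    c o (n - p) = (-1) ^ (o + 1) * (-1) ^ (a * (n + 1)) * c o p := by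
  set e : ℕ → ℕ → ℚ := fun o p => (-1) ^ (o + 1) * c o (n - p) - (-1) ^ (a * (n + 1)) * c o p
    with he
  have hev : ∀ t : ℕ, 0 ≤ t → pfEval n a e t = 0 := by
    intro t _
    have h1 : ∀ m, m ≤ n → (t : ℚ) + m + 1 ≠ 0 := fun m _ => by positivity
    have h2 : ∀ m, m ≤ n → (-(t : ℚ) - n - 2) + m + 1 ≠ 0 := by
      intro m hm h0
      have : ((m : ℚ)) ≤ n := by exact_mod_cast hm
      have ht0 : (0 : ℚ) ≤ t := by positivity
      linarith
    rw [he, pfEval_sub', pfEval_const_mul, pfEval_reflect, hc _ h2, hc _ h1, R_reflect]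
    ring
  have := pf_unique n a e 0 hev o p ho hp
  rw [he] at this
  simp only at this
  have hsq : ((-1 : ℚ) ^ (o + 1)) * ((-1 : ℚ) ^ (o + 1)) = 1 := by
    rw [← pow_add, ← two_mul, pow_mul]
    norm_num
  calc c o (n - p) = (((-1 : ℚ) ^ (o + 1)) * ((-1 : ℚ) ^ (o + 1))) * c o (n - p) := by
        rw [hsq, one_mul]
    _ = (-1) ^ (o + 1) * ((-1) ^ (a * (n + 1)) * c o p) := by
        rw [mul_assoc, show (-1 : ℚ) ^ (o + 1) * c o (n - p) = (-1) ^ (a * (n + 1)) * c o p by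
          linarith]
    _ = _ := by ring

/-- **The even zeta values drop out**: for `n` even and `a` odd, `∑_p c_{o,p} = 0` for every odd
`o` (i.e. `P_{i,n}(1) = 0` for even `i`; [Rivoal2000, Lemme 1]). [cite: Rivoal2000, §2 Lemme 1] -/
theorem sum_c_eq_zero_of_odd (a r n : ℕ) (hn : Even n) (ha : Odd a) (c : ℕ → ℕ → ℚ)
    (hc : ∀ t : ℚ, (∀ m, m ≤ n → t + m + 1 ≠ 0) → pfEval n a c t = R a r n t)
    (o : ℕ) (ho : o < a) (hodd : Odd o) : ∑ p ∈ range (n + 1), c o p = 0 := by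
  have hsign : ((-1 : ℚ) ^ (o + 1)) * ((-1 : ℚ) ^ (a * (n + 1))) = -1 := by
    have h1 : Even (o + 1) := hodd.add_one
    have h2 : Odd (a * (n + 1)) := ha.mul hn.add_one
    rw [h1.neg_one_pow, h2.neg_one_pow]
    norm_num
  have hrefl : ∑ p ∈ range (n + 1), c o p = ∑ p ∈ range (n + 1), c o (n - p) := by
    conv_lhs => rw [← sum_range_reflect]
    refine sum_congr rfl fun p _ => ?_
    simp
  have hneg : ∑ p ∈ range (n + 1), c o (n - p) = -∑ p ∈ range (n + 1), c o p := by
    rw [← neg_one_mul, mul_sum]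
    refine sum_congr rfl fun p hp => ?_
    rw [pf_R_symm a r n c hc o p ho (Nat.lt_succ_iff.1 (mem_range.1 hp)), hsign]
  linarith

/-! ### Size of `R_n` at the naturals -/

/-- A Pochhammer value with positive start is positive. [folklore] -/
theorem poch_pos {t : ℚ} (ht : 0 < t) (k : ℕ) : 0 < poch t k :=
  prod_pos fun s _ => by positivity

/-- `R_n(k) = 0` for naturals `k < rn` (the factor `(k-rn+1)_{rn}` vanishes). [folklore] -/
theorem R_natCast_eq_zero (a r n k : ℕ) (hk : k < r * n) : R a r n k = 0 := by
  rw [R]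
  have : poch ((k : ℚ) - r * n + 1) (r * n) = 0 := by
    rw [poch]
    exact prod_eq_zero (mem_range.2 (by omega : r * n - 1 - k < r * n)) (by
      rw [Nat.cast_sub (by omega : k ≤ r * n - 1), Nat.cast_sub (by omega : 1 ≤ r * n)]
      push_cast
      ring)
  rw [this]
  simp

/-- **`R_n(k) ≥ 0` on `ℕ`** (all factors are nonnegative). [folklore] -/
theorem R_natCast_nonneg (a r n k : ℕ) : 0 ≤ R a r n k := by
  rcases lt_or_ge k (r * n) with hk | hk
  · rw [R_natCast_eq_zero a r n k hk]
  · rw [R]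
    refine div_nonneg (mul_nonneg (mul_nonneg (by positivity) ?_) (poch_pos (by positivity) _).le)
      (pow_nonneg (poch_pos (by positivity) _).le _)
    refine prod_nonneg fun s _ => ?_
    have : ((r * n : ℕ) : ℚ) ≤ k := by exact_mod_cast hk
    push_cast at this
    linarith [(s.cast_nonneg : (0 : ℚ) ≤ s)]

/-- **Decay of `R_n` on `ℕ`**: if `2r + 1 ≤ a` there is `C ≥ 0` with `R_n(k) ≤ C/(k+1)²` for all
naturals `k` (for `1 ≤ r`; the order of `R_n` at infinity is `a(n+1) - 2rn ≥ 2`). [folklore] -/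
theorem R_natCast_le (a r n : ℕ) (hr : 1 ≤ r) (har : 2 * r + 1 ≤ a) :
    ∃ C : ℚ, 0 ≤ C ∧ ∀ k : ℕ, R a r n k ≤ C / ((k : ℚ) + 1) ^ 2 := by
  set C : ℚ := (n.factorial : ℚ) ^ (a - 2 * r) * poch ((n : ℚ) + 2) (r * n) with hC
  have hCpos : 0 ≤ C := by
    rw [hC]
    exact mul_nonneg (by positivity) (poch_pos (by positivity) _).le
  refine ⟨C, hCpos, fun k => ?_⟩
  have hk1 : (0 : ℚ) < (k : ℚ) + 1 := by positivity
  rcases lt_or_ge k (r * n) with hk | hk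
  · rw [R_natCast_eq_zero a r n k hk]
    positivity
  · have hD : 0 < poch ((k : ℚ) + 1) (n + 1) := poch_pos hk1 _
    rw [R, div_le_div_iff₀ (pow_pos hD _) (pow_pos hk1 2)]
    -- bounds for the three Pochhammer symbols
    have h1 : poch ((k : ℚ) - r * n + 1) (r * n) ≤ ((k : ℚ) + 1) ^ (r * n) := by
      rw [poch, show ((k : ℚ) + 1) ^ (r * n) = ∏ _s ∈ range (r * n), ((k : ℚ) + 1) by
        rw [prod_const, card_range]]
      refine prod_le_prod (fun s _ => ?_) (fun s hs => ?_)
      · have : ((r * n : ℕ) : ℚ) ≤ k := by exact_mod_cast hk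
        push_cast at this
        linarith [(s.cast_nonneg : (0 : ℚ) ≤ s)]
      · have hs' : s < r * n := mem_range.1 hs
        have : ((s : ℚ)) + 1 ≤ (r * n : ℕ) := by exact_mod_cast hs'
        push_cast at this
        linarith
    have h2 : poch ((k : ℚ) + n + 2) (r * n) ≤ ((k : ℚ) + 1) ^ (r * n) * poch ((n : ℚ) + 2) (r * n) := by
      rw [poch, poch, show ((k : ℚ) + 1) ^ (r * n) = ∏ _s ∈ range (r * n), ((k : ℚ) + 1) by
        rw [prod_const, card_range], ← prod_mul_distrib]
      refine prod_le_prod (fun s _ => by positivity) (fun s _ => ?_)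
      have hk0 : (0 : ℚ) ≤ k := by positivity
      have hs0 : (0 : ℚ) ≤ s := by positivity
      have hn0 : (0 : ℚ) ≤ n := by positivity
      nlinarith
    have h3 : ((k : ℚ) + 1) ^ (n + 1) ≤ poch ((k : ℚ) + 1) (n + 1) := by
      rw [poch, show ((k : ℚ) + 1) ^ (n + 1) = ∏ _s ∈ range (n + 1), ((k : ℚ) + 1) by
        rw [prod_const, card_range]]
      refine prod_le_prod (fun s _ => by positivity) (fun s _ => ?_)
      linarith [(s.cast_nonneg : (0 : ℚ) ≤ s)]
    have h4 : ((k : ℚ) + 1) ^ (a * (n + 1)) ≤ poch ((k : ℚ) + 1) (n + 1) ^ a := by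
      rw [pow_mul']
      exact pow_le_pow_left₀ (by positivity) h3 a
    have hexp : 2 * (r * n) + 2 ≤ a * (n + 1) := by
      have h6 : 2 * (r * n) + 2 ≤ (2 * r + 1) * (n + 1) := by
        ring_nf
        omega
      exact h6.trans (Nat.mul_le_mul_right _ har)
    have h5 : ((k : ℚ) + 1) ^ (2 * (r * n) + 2) ≤ ((k : ℚ) + 1) ^ (a * (n + 1)) :=
      pow_le_pow_right₀ (by linarith) hexp
    calc (n.factorial : ℚ) ^ (a - 2 * r) * poch ((k : ℚ) - r * n + 1) (r * n) *
          poch ((k : ℚ) + n + 2) (r * n) * ((k : ℚ) + 1) ^ 2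
        ≤ (n.factorial : ℚ) ^ (a - 2 * r) * ((k : ℚ) + 1) ^ (r * n) *
            (((k : ℚ) + 1) ^ (r * n) * poch ((n : ℚ) + 2) (r * n)) * ((k : ℚ) + 1) ^ 2 := by
          gcongr
          exact prod_nonneg fun s _ => by
            have : ((r * n : ℕ) : ℚ) ≤ k := by exact_mod_cast hk
            push_cast at this
            linarith [(s.cast_nonneg : (0 : ℚ) ≤ s)]
      _ = C * ((k : ℚ) + 1) ^ (2 * (r * n) + 2) := by rw [hC]; ring
      _ ≤ C * poch ((k : ℚ) + 1) (n + 1) ^ a := by gcongr; exact h5.trans h4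

/-! ### `∑_p c_{0,p} = 0` -/

/-- The limit `k · ∑_{p,o} c_{o,p}/(k+p+1)^{o+1} → ∑_p c_{0,p}` (`k → ∞`). [folklore] -/
theorem tendsto_mul_pfEval (n K : ℕ) (c : ℕ → ℕ → ℚ) :
    Tendsto (fun k : ℕ => (k : ℝ) * (pfEval n K c k : ℝ)) atTop
      (𝓝 (∑ p ∈ range (n + 1), ∑ o ∈ range K, (c o p : ℝ) * (0 : ℝ) ^ o)) := by
  have hf : ∀ k : ℕ, (k : ℝ) * (pfEval n K c k : ℝ) =
      ∑ p ∈ range (n + 1), ∑ o ∈ range K,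
        (c o p : ℝ) * (((k : ℝ) / ((k : ℝ) + ((p : ℝ) + 1))) * (1 / ((k : ℝ) + ((p : ℝ) + 1))) ^ o) := by
    intro k
    rw [pfEval]
    push_cast
    rw [mul_sum]
    refine sum_congr rfl fun p _ => ?_
    rw [mul_sum]
    refine sum_congr rfl fun o _ => ?_
    have hx : (k : ℝ) + ((p : ℝ) + 1) = (k : ℝ) + p + 1 := by ring
    rw [hx, one_div_pow, div_mul_div_comm, mul_one, ← pow_succ']
    ring
  simp_rw [hf]
  refine tendsto_finsetSum _ fun p _ => tendsto_finsetSum _ fun o _ => ?_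
  have h1 : Tendsto (fun k : ℕ => (k : ℝ) / ((k : ℝ) + ((p : ℝ) + 1))) atTop (𝓝 1) :=
    tendsto_natCast_div_add_atTop ((p : ℝ) + 1)
  have h2 : Tendsto (fun k : ℕ => (1 : ℝ) / ((k : ℝ) + ((p : ℝ) + 1))) atTop (𝓝 0) := by
    have h := (tendsto_one_div_add_atTop_nhds_zero_nat (𝕜 := ℝ)).comp (tendsto_add_atTop_nat p)
    refine h.congr fun k => ?_
    simp only [Function.comp_apply]
    push_cast
    ring
  have h3 := (h1.mul (h2.pow o)).const_mul (c o p : ℝ)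
  simpa using h3

/-- **`∑_p c_{0,p} = 0`** for the partial fraction coefficients of `R_n` (`2r + 1 ≤ a`): both
`k R_n(k) → 0` and `k R_n(k) → ∑_p c_{0,p}` (this is "la convergence de la série `S_n(1)`
implique …" of [Rivoal2000, proof of Lemme 1]). [cite: Rivoal2000, §2 proof of Lemme 1] -/
theorem sum_c_zero_eq_zero (a r n : ℕ) (hr : 1 ≤ r) (har : 2 * r + 1 ≤ a) (c : ℕ → ℕ → ℚ)
    (hc : ∀ t : ℚ, (∀ m, m ≤ n → t + m + 1 ≠ 0) → pfEval n a c t = R a r n t) :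
    ∑ p ∈ range (n + 1), c 0 p = 0 := by
  have ha : 1 ≤ a := by omega
  have hlim1 := tendsto_mul_pfEval n a c
  have hval : ∑ p ∈ range (n + 1), ∑ o ∈ range a, (c o p : ℝ) * (0 : ℝ) ^ o =
      ((∑ p ∈ range (n + 1), c 0 p : ℚ) : ℝ) := by
    push_cast
    refine sum_congr rfl fun p _ => ?_
    obtain ⟨a', rfl⟩ : ∃ a', a = a' + 1 := ⟨a - 1, by omega⟩
    rw [sum_range_succ']
    simp
  rw [hval] at hlim1
  obtain ⟨C, hC0, hC⟩ := R_natCast_le a r n hr har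
  have hlim2 : Tendsto (fun k : ℕ => (k : ℝ) * (pfEval n a c k : ℝ)) atTop (𝓝 0) := by
    have hpos : ∀ k : ℕ, ∀ m, m ≤ n → (k : ℚ) + m + 1 ≠ 0 := fun k m _ => by positivity
    refine squeeze_zero (fun k => ?_) (fun k => ?_)
      ((tendsto_const_div_atTop_nhds_zero_nat (C : ℝ)).comp (tendsto_add_atTop_nat 1))
    · rw [hc _ (hpos k)]
      have := R_natCast_nonneg a r n k
      positivity
    · rw [hc _ (hpos k)]
      simp only [Function.comp_apply]
      have h := hC k
      have hk : (0 : ℝ) ≤ k := by positivity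
      have hR : ((R a r n k : ℚ) : ℝ) ≤ (C : ℝ) / ((k : ℝ) + 1) ^ 2 := by exact_mod_cast h
      calc (k : ℝ) * (R a r n k : ℝ) ≤ (k : ℝ) * ((C : ℝ) / ((k : ℝ) + 1) ^ 2) := by gcongr
        _ ≤ ((k : ℝ) + 1) * ((C : ℝ) / ((k : ℝ) + 1) ^ 2) := by gcongr; linarith
        _ = (C : ℝ) / (((k + 1 : ℕ) : ℝ)) := by push_cast; field_simp
  have := tendsto_nhds_unique hlim1 hlim2
  exact_mod_cast this

/-! ### Lemme 1: `S_n(1)` as a linear form in zeta values -/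

/-- The truncated zeta sums `H_p^{(i)} = ∑_{m=1}^{p} m^{-i}`. [folklore] -/
def harm (i p : ℕ) : ℚ := ∑ m ∈ range p, 1 / ((m : ℚ) + 1) ^ i

/-- `∑_{k ≥ 0} (k+p+1)^{-i} = ζ(i) - H_p^{(i)}` for `i ≥ 2`. [folklore] -/
theorem hasSum_one_div_pow_shift (i p : ℕ) (hi : 2 ≤ i) :
    HasSum (fun k : ℕ => 1 / ((k : ℝ) + p + 1) ^ i) (zetaValue i - (harm i p : ℝ)) := by
  have hs : Summable (fun m : ℕ => 1 / (m : ℝ) ^ i) := Real.summable_one_div_nat_pow.2 hi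
  have h := (hasSum_nat_add_iff' (f := fun m : ℕ => 1 / (m : ℝ) ^ i) (p + 1)).2 hs.hasSum
  have hval : ∑ m ∈ range (p + 1), 1 / ((m : ℕ) : ℝ) ^ i = (harm i p : ℝ) := by
    rw [sum_range_succ', harm]
    push_cast
    rw [zero_pow (by omega), div_zero, add_zero]
  rw [zetaValue]
  rw [hval] at h
  refine h.congr_fun fun k => ?_
  push_cast
  ring_nf

/-- `∑_{k ≥ 0} (1/(k+1) - 1/(k+p+1)) = H_p^{(1)}` (a telescoping sum of nonnegative terms).
[folklore] -/
theorem hasSum_sub_shift (p : ℕ) :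
    HasSum (fun k : ℕ => 1 / ((k : ℝ) + 1) - 1 / ((k : ℝ) + p + 1)) (harm 1 p : ℝ) := by
  have hnn : ∀ k : ℕ, 0 ≤ 1 / ((k : ℝ) + 1) - 1 / ((k : ℝ) + p + 1) := by
    intro k
    rw [sub_nonneg]
    exact one_div_le_one_div_of_le (by positivity) (by linarith [(p.cast_nonneg : (0 : ℝ) ≤ p)])
  rw [hasSum_iff_tendsto_nat_of_nonneg hnn]
  set f : ℕ → ℝ := fun j => 1 / ((j : ℝ) + 1) with hf
  have hpartial : ∀ K : ℕ, ∑ k ∈ range K, (1 / ((k : ℝ) + 1) - 1 / ((k : ℝ) + p + 1)) =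
      (harm 1 p : ℝ) - ∑ x ∈ range p, f (K + x) := by
    intro K
    have h1 : ∑ k ∈ range K, 1 / ((k : ℝ) + p + 1) = ∑ k ∈ range K, f (p + k) := by
      refine sum_congr rfl fun k _ => ?_
      rw [hf]
      push_cast
      ring_nf
    have h2 : ∑ x ∈ range (p + K), f x = ∑ x ∈ range p, f x + ∑ k ∈ range K, f (p + k) :=
      sum_range_add f p K
    have h3 : ∑ x ∈ range (K + p), f x = ∑ x ∈ range K, f x + ∑ x ∈ range p, f (K + x) :=
      sum_range_add f K p
    have h4 : (harm 1 p : ℝ) = ∑ x ∈ range p, f x := by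
      rw [harm, hf]
      push_cast
      simp
    rw [sum_sub_distrib, h1, h4]
    have : p + K = K + p := add_comm _ _
    rw [this] at h2
    have h5 : ∑ k ∈ range K, 1 / ((k : ℝ) + 1) = ∑ x ∈ range K, f x := rfl
    rw [h5]
    linarith
  simp_rw [hpartial]
  have hlim : Tendsto (fun K : ℕ => ∑ x ∈ range p, f (K + x)) atTop (𝓝 0) := by
    have : (0 : ℝ) = ∑ _x ∈ range p, (0 : ℝ) := by simp
    rw [this]
    refine tendsto_finsetSum _ fun x _ => ?_
    exact (tendsto_one_div_add_atTop_nhds_zero_nat (𝕜 := ℝ)).comp (tendsto_add_atTop_nat x)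
  simpa using (tendsto_const_nhds (x := (harm 1 p : ℝ))).sub hlim

/-- **Rivoal's Lemme 1, the expansion**: with the partial fraction coefficients `c_{o,p}` of
`R_n` (`1 ≤ r`, `2r + 1 ≤ a`), the series `S_n(1) = ∑_{k ≥ 0} R_n(k)` converges and
`S_n(1) = ∑_{1 ≤ o < a} (∑_p c_{o,p}) ζ(o+1) - ∑_{o < a} ∑_p c_{o,p} H_p^{(o+1)}`
(the term `o = 0` of the first sum is absent because `∑_p c_{0,p} = 0`). In Rivoal's notation,
`S_n(1) = P_{0,n}(1) + ∑_{i=2}^{a} P_{i,n}(1) ζ(i)`. [cite: Rivoal2000, §2 Lemme 1] -/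
theorem hasSum_R (a r n : ℕ) (hr : 1 ≤ r) (har : 2 * r + 1 ≤ a) (c : ℕ → ℕ → ℚ)
    (hc : ∀ t : ℚ, (∀ m, m ≤ n → t + m + 1 ≠ 0) → pfEval n a c t = R a r n t) :
    HasSum (fun k : ℕ => (R a r n k : ℝ))
      (∑ o ∈ Ico 1 a, (∑ p ∈ range (n + 1), (c o p : ℝ)) * zetaValue (o + 1) -
        ∑ o ∈ range a, ∑ p ∈ range (n + 1), (c o p : ℝ) * (harm (o + 1) p : ℝ)) := by
  have ha : 1 ≤ a := by omega
  have hpos : ∀ k : ℕ, ∀ m, m ≤ n → (k : ℚ) + m + 1 ≠ 0 := fun k m _ => by positivity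
  have hz := sum_c_zero_eq_zero a r n hr har c hc
  -- pointwise expansion of `R_n(k)`
  have hexp : ∀ k : ℕ, (R a r n k : ℝ) =
      ∑ o ∈ Ico 1 a, ∑ p ∈ range (n + 1), (c o p : ℝ) * (1 / ((k : ℝ) + p + 1) ^ (o + 1)) +
        ∑ p ∈ range (n + 1), (c 0 p : ℝ) * (-(1 / ((k : ℝ) + 1) - 1 / ((k : ℝ) + p + 1))) := by
    intro k
    rw [← hc _ (hpos k), pfEval, sum_comm, range_eq_Ico, sum_eq_sum_Ico_succ_bot ha, add_comm]
    push_cast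
    congr 1
    · refine sum_congr rfl fun o _ => sum_congr rfl fun p _ => ?_
      rw [div_eq_mul_one_div]
    · simp only [pow_one]
      have hz' : ∑ p ∈ range (n + 1), (c 0 p : ℝ) * (1 / ((k : ℝ) + 1)) = 0 := by
        rw [← sum_mul]
        have : ∑ p ∈ range (n + 1), (c 0 p : ℝ) = 0 := by exact_mod_cast hz
        rw [this, zero_mul]
      calc ∑ p ∈ range (n + 1), (c 0 p : ℝ) / ((k : ℝ) + p + 1)
          = ∑ p ∈ range (n + 1), (c 0 p : ℝ) / ((k : ℝ) + p + 1) -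
              ∑ p ∈ range (n + 1), (c 0 p : ℝ) * (1 / ((k : ℝ) + 1)) := by rw [hz', sub_zero]
        _ = _ := by
            rw [← sum_sub_distrib]
            exact sum_congr rfl fun p _ => by ring
  have hA : ∀ o ∈ Ico 1 a, HasSum (fun k : ℕ => ∑ p ∈ range (n + 1),
      (c o p : ℝ) * (1 / ((k : ℝ) + p + 1) ^ (o + 1)))
      (∑ p ∈ range (n + 1), (c o p : ℝ) * (zetaValue (o + 1) - (harm (o + 1) p : ℝ))) := by
    intro o ho
    have ho' : 2 ≤ o + 1 := by have := (mem_Ico.1 ho).1; omega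
    exact hasSum_sum fun p _ => (hasSum_one_div_pow_shift (o + 1) p ho').mul_left _
  have hB : ∀ p ∈ range (n + 1), HasSum (fun k : ℕ =>
      (c 0 p : ℝ) * (-(1 / ((k : ℝ) + 1) - 1 / ((k : ℝ) + p + 1)))) ((c 0 p : ℝ) * (-(harm 1 p : ℝ))) := by
    intro p _
    have h := ((hasSum_sub_shift p).mul_left (c 0 p : ℝ)).neg
    have e1 : (fun k : ℕ => (c 0 p : ℝ) * (-(1 / ((k : ℝ) + 1) - 1 / ((k : ℝ) + p + 1)))) =
        fun k : ℕ => -((c 0 p : ℝ) * (1 / ((k : ℝ) + 1) - 1 / ((k : ℝ) + p + 1))) :=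
      funext fun k => by ring
    rw [e1, show (c 0 p : ℝ) * (-(harm 1 p : ℝ)) = -((c 0 p : ℝ) * harm 1 p) by ring]
    exact h
  have hAB := (hasSum_sum hA).add (hasSum_sum hB)
  rw [show (fun k : ℕ => (R a r n k : ℝ)) = fun k : ℕ =>
      ∑ o ∈ Ico 1 a, ∑ p ∈ range (n + 1), (c o p : ℝ) * (1 / ((k : ℝ) + p + 1) ^ (o + 1)) +
        ∑ p ∈ range (n + 1), (c 0 p : ℝ) * (-(1 / ((k : ℝ) + 1) - 1 / ((k : ℝ) + p + 1)))
      from funext hexp]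
  convert hAB using 1
  -- the value
  rw [range_eq_Ico a, sum_eq_sum_Ico_succ_bot ha]
  simp only [mul_sub, sum_sub_distrib, sum_mul, mul_neg, sum_neg_distrib, zero_add]
  ring

/-! ### Lemme 5: the denominators -/

/-- `d^i H_p^{(i)} ∈ ℤ` for a common multiple `d` of `1, …, n` and `p ≤ n`. [folklore] -/
theorem isInt_dpow_mul_harm (n d : ℕ) (hdiv : ∀ k : ℕ, 1 ≤ k → k ≤ n → (k : ℤ) ∣ d)
    (i p : ℕ) (hp : p ≤ n) : ∃ z : ℤ, (d : ℚ) ^ i * harm i p = z := by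
  have hm : ∀ m ∈ range p, ∃ z : ℤ, (d : ℚ) ^ i * (1 / ((m : ℚ) + 1) ^ i) = z := by
    intro m hmem
    have hm' : m + 1 ≤ n := (mem_range.1 hmem).trans_le hp |> Nat.succ_le_of_lt |>.trans (le_refl _)
    obtain ⟨w, hw⟩ := hdiv (m + 1) (by omega) (by omega)
    refine ⟨w ^ i, ?_⟩
    have hwq : (d : ℚ) = ((m : ℚ) + 1) * w := by exact_mod_cast hw
    rw [hwq, mul_pow]
    have : ((m : ℚ) + 1) ≠ 0 := by positivity
    field_simp
    push_cast
    ring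
  choose z hz using hm
  refine ⟨∑ m ∈ (range p).attach, z m.1 m.2, ?_⟩
  rw [harm, mul_sum, ← sum_attach]
  push_cast
  exact sum_congr rfl fun m _ => hz m.1 m.2

/-- **Rivoal's Lemme 5 for the coefficients of the zeta values**: `d^a ∑_p c_{o,p} ∈ ℤ`
(`o < a`), for data with `d^{a-1-o} c_{o,p} ∈ ℤ`. [cite: Rivoal2000, §2 Lemme 5] -/
theorem isInt_dpow_mul_sum_c (n a d : ℕ) (c : ℕ → ℕ → ℚ) (hint : IsInt a d c) (o : ℕ)
    (ho : o < a) : ∃ z : ℤ, (d : ℚ) ^ a * ∑ p ∈ range (n + 1), c o p = z := by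
  have hp : ∀ p ∈ range (n + 1), ∃ z : ℤ, (d : ℚ) ^ a * c o p = z := by
    intro p _
    obtain ⟨w, hw⟩ := hint o p
    refine ⟨d ^ (o + 1) * w, ?_⟩
    have : a = (o + 1) + (a - 1 - o) := by omega
    rw [this, pow_add, mul_assoc, hw]
    push_cast
    ring
  choose z hz using hp
  refine ⟨∑ p ∈ (range (n + 1)).attach, z p.1 p.2, ?_⟩
  rw [mul_sum, ← sum_attach]
  push_cast
  exact sum_congr rfl fun p _ => hz p.1 p.2

/-- **Rivoal's Lemme 5 for the constant term**: `d^a ∑_{o<a} ∑_p c_{o,p} H_p^{(o+1)} ∈ ℤ`.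
[cite: Rivoal2000, §2 Lemme 5] -/
theorem isInt_dpow_mul_P0 (n a d : ℕ) (hdiv : ∀ k : ℕ, 1 ≤ k → k ≤ n → (k : ℤ) ∣ d)
    (c : ℕ → ℕ → ℚ) (hint : IsInt a d c) :
    ∃ z : ℤ, (d : ℚ) ^ a * ∑ o ∈ range a, ∑ p ∈ range (n + 1), c o p * harm (o + 1) p = z := by
  have hterm : ∀ o ∈ range a, ∀ p ∈ range (n + 1),
      ∃ z : ℤ, (d : ℚ) ^ a * (c o p * harm (o + 1) p) = z := by
    intro o ho p hp
    obtain ⟨w, hw⟩ := hint o p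
    obtain ⟨v, hv⟩ := isInt_dpow_mul_harm n d hdiv (o + 1) p (Nat.lt_succ_iff.1 (mem_range.1 hp))
    refine ⟨w * v, ?_⟩
    have ho' := mem_range.1 ho
    have : a = (a - 1 - o) + (o + 1) := by omega
    rw [this, pow_add]
    calc (d : ℚ) ^ (a - 1 - o) * (d : ℚ) ^ (o + 1) * (c o p * harm (o + 1) p)
        = ((d : ℚ) ^ (a - 1 - o) * c o p) * ((d : ℚ) ^ (o + 1) * harm (o + 1) p) := by ring
      _ = _ := by rw [hw, hv]; push_cast; ring
  choose z hz using hterm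
  refine ⟨∑ o ∈ (range a).attach, ∑ p ∈ (range (n + 1)).attach, z o.1 o.2 p.1 p.2, ?_⟩
  rw [mul_sum, ← sum_attach]
  push_cast
  refine sum_congr rfl fun o _ => ?_
  rw [mul_sum, ← sum_attach]
  exact sum_congr rfl fun p _ => hz o.1 o.2 p.1 p.2

end BallRivoal

end Literature.NumberTheory.Transcendental
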